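import Literature.Probability.MarkovChains.PathGraphResistance
import Literature.Probability.MarkovChains.KemenyConstantResistance
import HarnessLib

/-!
# The path `P_n`: degree sums, the moment `μ(P_n, j) = (n−j)² + (j−1)²` and Kemeny's constant
# `𝒦(P_n) = (2n² − 4n + 3)/6` (Faught–Kempton–Knudson, Proposition 3.2)

Source (read at the page; VERBATIM). N. Faught, M. Kempton, A. Knudson, *A 1-separation formula for the graph Kemeny
constant and Braess edges*, J. Math. Chem. 60 (2022) 49–69, arXiv:2108.01061 [FaughtKemptonKnudson2021] (held text
`paper:arxiv-2108.01061`, p0003, p0009): Definition 1.6 «The moment of a graph `G` at vertex `v` is given by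
`μ(G, v) = dᵀRe_v = Σ_{i ∈ V(G)} d_i r_G(i,v)`»; Lemma 1.1 «`𝒦(G) = dᵀRd/(4m)`» (the tree's `PalaciosRenom2010_cor_1`);
Proposition 3.1 «`r_{P_n}(i,j) = d(i,j)`» (the tree's `FaughtKemptonKnudson2021_prop_3_1_path`); **Proposition 3.2** «Let
`K_n`, `P_n`, and `S_n` be, respectively, the complete graph, path graph, and star graph on `n` vertices
`{1, 2, …, n}`. […] `𝒦(P_n) = (2n² − 4n + 3)/6` […] `μ(P_n, j) = (n−j)² + (j−1)²`».

## Tree vocabulary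

Mathlib's `pathGraph n` on `Fin n` (labels `0, …, n−1`; the paper's vertex `j` is the label `j − 1`), degrees
`(pathGraph n).degree`, unit conductances `(pathGraph n).adjMatrix ℝ` (any `DecidableRel` instance), the simple random
walk `srwKernel`, `degreeLaw`, hitting times `IsHittingTimeSolution`, `𝒦 = targetTime (degreeLaw ·) h i`.

* `sum_ite_adj_pathGraph`, `sum_degree_mul_pathGraph` — the degree sequence `1, 2, …, 2, 1`: `Σ_x d_x f(x) = 2 Σ_x f(x) −
  f(0) − f(n−1)` [cite: FaughtKemptonKnudson2021, §3 Prop. 3.2 (the path `P_n`)];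
* `sum_range_abs_sub_eq` — `Σ_{i<n} |j − i| = j(j+1)/2 + (n−1−j)(n−j)/2`;
* `FaughtKemptonKnudson2021_prop_3_2_moment_path` — **`μ(P_n, j) = Σ_i d_i r(i,j) = j² + (n−1−j)²`** (labels from `0`;
  the printed `(n−j)² + (j−1)²` for labels from `1`);
* `FaughtKemptonKnudson2021_prop_3_2_path` — **`𝒦(P_n) = (2n² − 4n + 3)/6`** (`n = k + 2 ≥ 2`).

THEOREMS ONLY (no definition, no named fact, net debt 0).
-/

noncomputable section

open Finset Matrix SimpleGraph
open Literature.Combinatorics.SimpleGraph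

namespace Literature.Probability.MarkovChains

/-! ## §1 The degree sequence of `P_n`: `Σ_x d_x f(x) = 2 Σ_x f(x) − f(0) − f(n−1)` -/

/-- The neighbours of `x` in `P_n` counted: `Σ_y [x ∼ y] = 2 − [x = 0] − [x = n−1]` (`n ≥ 2`).
[cite: FaughtKemptonKnudson2021, §3 Prop. 3.2 (the path graph `P_n`; degrees `1, 2, …, 2, 1`)] -/
theorem sum_ite_adj_pathGraph {k : ℕ} [DecidableRel (pathGraph (k + 2)).Adj] (x : Fin (k + 2)) :
    ∑ y, (if (pathGraph (k + 2)).Adj x y then (1 : ℝ) else 0) =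
      2 - (if (x : ℕ) = 0 then 1 else 0) - (if (x : ℕ) = k + 1 then 1 else 0) := by
  have hx := x.isLt
  simp_rw [pathGraph_adj]
  rw [Fin.sum_univ_eq_sum_range (fun j : ℕ => if (x : ℕ) + 1 = j ∨ j + 1 = (x : ℕ) then (1 : ℝ) else 0) (k + 2)]
  have hsplit : ∀ j ∈ range (k + 2), (if (x : ℕ) + 1 = j ∨ j + 1 = (x : ℕ) then (1 : ℝ) else 0) =
      (if j = (x : ℕ) + 1 then 1 else 0) + (if j + 1 = (x : ℕ) then 1 else 0) := by
    intro j _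
    by_cases h1 : j = (x : ℕ) + 1
    · have h2 : ¬ j + 1 = (x : ℕ) := by omega
      rw [if_pos (Or.inl h1.symm), if_pos h1, if_neg h2, add_zero]
    · by_cases h2 : j + 1 = (x : ℕ)
      · rw [if_pos (Or.inr h2), if_neg h1, if_pos h2, zero_add]
      · rw [if_neg (by omega), if_neg h1, if_neg h2, add_zero]
  rw [sum_congr rfl hsplit, sum_add_distrib, sum_ite_eq' (range (k + 2)) ((x : ℕ) + 1)]
  simp only [mem_range]
  -- the left neighbour
  have hleft : ∑ j ∈ range (k + 2), (if j + 1 = (x : ℕ) then (1 : ℝ) else 0) = if (x : ℕ) = 0 then 0 else 1 := by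
    by_cases h0 : (x : ℕ) = 0
    · rw [if_pos h0]
      exact sum_eq_zero fun j _ => if_neg (by omega)
    · rw [if_neg h0]
      have h' : ∀ j ∈ range (k + 2), (if j + 1 = (x : ℕ) then (1 : ℝ) else 0) = if j = (x : ℕ) - 1 then 1 else 0 :=
        fun j _ => by
          by_cases hj : j + 1 = (x : ℕ)
          · rw [if_pos hj, if_pos (by omega)]
          · rw [if_neg hj, if_neg (by omega)]
      rw [sum_congr rfl h', sum_ite_eq' (range (k + 2)) ((x : ℕ) - 1), if_pos (mem_range.2 (by omega))]
  rw [hleft]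
  by_cases h0 : (x : ℕ) = 0
  · rw [if_pos h0, if_pos h0, if_pos (by omega), if_neg (by omega)]
    norm_num
  · rw [if_neg h0, if_neg h0]
    by_cases hl : (x : ℕ) = k + 1
    · rw [if_neg (by omega), if_pos hl]
      norm_num
    · rw [if_pos (by omega), if_neg hl]
      norm_num

/-- **`Σ_x d_x f(x) = 2 Σ_x f(x) − f(0) − f(n−1)` on the path `P_n`** (degrees `1, 2, …, 2, 1`, `n ≥ 2`).
[cite: FaughtKemptonKnudson2021, §3 Prop. 3.2 (the path graph `P_n`)] -/
theorem sum_degree_mul_pathGraph {k : ℕ} [DecidableRel (pathGraph (k + 2)).Adj] (f : Fin (k + 2) → ℝ) :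
    ∑ x, ((pathGraph (k + 2)).degree x : ℝ) * f x = 2 * ∑ x, f x - f 0 - f (Fin.last (k + 1)) := by
  simp_rw [degree_eq_sum_if_adj, sum_ite_adj_pathGraph, sub_mul, Finset.sum_sub_distrib, ← Finset.mul_sum, ite_mul,
    one_mul, zero_mul]
  have h0 : ∀ x : Fin (k + 2), (if (x : ℕ) = 0 then f x else 0) = if x = 0 then f x else 0 := fun x => by
    by_cases h : (x : ℕ) = 0 <;> simp [h, Fin.ext_iff]
  have hl : ∀ x : Fin (k + 2), (if (x : ℕ) = k + 1 then f x else 0) = if x = Fin.last (k + 1) then f x else 0 := fun x => by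
    by_cases h : (x : ℕ) = k + 1 <;> simp [h, Fin.ext_iff]
  simp_rw [h0, hl, Finset.sum_ite_eq' univ, if_pos (mem_univ _)]

/-! ## §2 `Σ_{i<n} |j − i|` in closed form -/

/-- `Σ_{i ≤ j} (j − i) = j(j+1)/2`. [folklore] -/
private theorem sum_range_succ_sub_cast (j : ℕ) : ∑ i ∈ range (j + 1), ((j : ℝ) - (i : ℝ)) = (j : ℝ) * ((j : ℝ) + 1) / 2 := by
  have h : ∀ n : ℕ, ∑ i ∈ range n, (i : ℝ) = (n : ℝ) * ((n : ℝ) - 1) / 2 := by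
    intro n
    induction n with
    | zero => simp
    | succ n ih =>
      rw [sum_range_succ, ih]
      push_cast
      ring
  rw [sum_sub_distrib, sum_const, card_range, nsmul_eq_mul, h]
  push_cast
  ring

/-- **`Σ_{i<n} |j − i| = j(j+1)/2 + (n−1−j)(n−j)/2`** for `j < n` (distances from `j` along the path).
[cite: FaughtKemptonKnudson2021, §3 Prop. 3.2 (behind `μ(P_n, j)`)] -/
theorem sum_range_abs_sub_eq {j n : ℕ} (h : j < n) :
    ∑ i ∈ range n, |(j : ℝ) - (i : ℝ)| =
      (j : ℝ) * ((j : ℝ) + 1) / 2 + ((n : ℝ) - 1 - (j : ℝ)) * ((n : ℝ) - (j : ℝ)) / 2 := by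
  induction n, h using Nat.le_induction with
  | base =>
    rw [show ∑ i ∈ range (j + 1), |(j : ℝ) - (i : ℝ)| = ∑ i ∈ range (j + 1), ((j : ℝ) - (i : ℝ)) from
      sum_congr rfl fun i hi => abs_of_nonneg (sub_nonneg.2 (Nat.cast_le.2 (by
        have := mem_range.1 hi
        omega))), sum_range_succ_sub_cast]
    push_cast
    ring
  | succ n hn ih =>
    rw [sum_range_succ, ih, abs_of_nonpos (sub_nonpos.2 (Nat.cast_le.2 (by omega)))]
    push_cast
    ring

/-- The same over `Fin n`: `Σ_i |j − i| = j(j+1)/2 + (n−1−j)(n−j)/2`. [cite: FaughtKemptonKnudson2021, §3 Prop. 3.2] -/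
theorem sum_abs_sub_fin {n : ℕ} (j : Fin n) :
    ∑ i : Fin n, |((j : ℕ) : ℝ) - ((i : ℕ) : ℝ)| =
      ((j : ℕ) : ℝ) * (((j : ℕ) : ℝ) + 1) / 2 + ((n : ℝ) - 1 - ((j : ℕ) : ℝ)) * ((n : ℝ) - ((j : ℕ) : ℝ)) / 2 := by
  rw [Fin.sum_univ_eq_sum_range (fun i : ℕ => |((j : ℕ) : ℝ) - (i : ℝ)|) n, sum_range_abs_sub_eq j.isLt]

/-! ## §3 Proposition 3.2 for the path: the moment and Kemeny's constant -/

/-- **PROPOSITION 3.2, the moment of the path: `μ(P_n, j) = Σ_i d_i r(i,j) = j² + (n−1−j)²`** for the label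
`j ∈ {0, …, n−1}` (the printed «`μ(P_n, j) = (n−j)² + (j−1)²`» for labels `1, …, n`), `n = k + 2 ≥ 2`.
[cite: FaughtKemptonKnudson2021, §3 Prop. 3.2 with Def. 1.6 and Prop. 3.1] -/
theorem FaughtKemptonKnudson2021_prop_3_2_moment_path {k : ℕ} [DecidableRel (pathGraph (k + 2)).Adj]
    (j : Fin (k + 2)) :
    ∑ i, ((pathGraph (k + 2)).degree i : ℝ) * effectiveResistance ((pathGraph (k + 2)).adjMatrix ℝ) i j =
      ((j : ℕ) : ℝ) ^ 2 + (((k : ℝ) + 1) - ((j : ℕ) : ℝ)) ^ 2 := by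
  have hj := j.isLt
  have hjr : ((j : ℕ) : ℝ) ≤ (k : ℝ) + 1 := by exact_mod_cast (show (j : ℕ) ≤ k + 1 by omega)
  simp_rw [FaughtKemptonKnudson2021_prop_3_1_path]
  rw [sum_degree_mul_pathGraph]
  simp_rw [abs_sub_comm (((_ : Fin (k + 2)) : ℕ) : ℝ) (((j : Fin (k + 2)) : ℕ) : ℝ)]
  rw [sum_abs_sub_fin j]
  simp only [Fin.val_zero, Fin.val_last, Nat.cast_zero, sub_zero, Nat.cast_add, Nat.cast_one, Nat.cast_ofNat]
  rw [abs_of_nonneg (Nat.cast_nonneg _), abs_of_nonpos (by linarith)]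
  ring

/-- `|E(P_n)| = n − 1`. [cite: FaughtKemptonKnudson2021, §1.1 Lemma 1.1 (`m = |E|`) with §3 Prop. 3.2 (the path)] -/
theorem card_edgeFinset_pathGraph (k : ℕ) [DecidableRel (pathGraph (k + 1)).Adj] :
    #(pathGraph (k + 1)).edgeFinset = k := by
  have h := (isTree_pathGraph k).card_edgeFinset
  rw [Fintype.card_fin] at h
  omega

/-- `Σ_{x<n} x² = n(n−1)(2n−1)/6`. [folklore] -/
private theorem sum_range_cast_sq_sixth (n : ℕ) :
    ∑ i ∈ range n, (i : ℝ) ^ 2 = (n : ℝ) * ((n : ℝ) - 1) * (2 * (n : ℝ) - 1) / 6 := by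
  induction n with
  | zero => simp
  | succ n ih =>
    rw [sum_range_succ, ih]
    push_cast
    ring

/-- `Σ_{x<n} x = n(n−1)/2`. [folklore] -/
private theorem sum_range_cast_id_half (n : ℕ) : ∑ i ∈ range n, (i : ℝ) = (n : ℝ) * ((n : ℝ) - 1) / 2 := by
  induction n with
  | zero => simp
  | succ n ih =>
    rw [sum_range_succ, ih]
    push_cast
    ring

/-- **PROPOSITION 3.2, Kemeny's constant of the path: `𝒦(P_n) = (2n² − 4n + 3)/6`** (`n = k + 2 ≥ 2`; `𝒦 = Σ_j π_j m_ij`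
of the simple random walk, any start `i`), by Lemma 1.1 `𝒦 = (1/4m) Σ_x d_x μ(P_n, x)` with `m = n − 1`.
[cite: FaughtKemptonKnudson2021, §3 Prop. 3.2 (with Lemma 1.1, Def. 1.6, Prop. 3.1)] -/
theorem FaughtKemptonKnudson2021_prop_3_2_path {k : ℕ} [DecidableRel (pathGraph (k + 2)).Adj]
    {h : Fin (k + 2) → Fin (k + 2) → ℝ} (hh : IsHittingTimeSolution (srwKernel (pathGraph (k + 2))) h)
    (i : Fin (k + 2)) :
    targetTime (degreeLaw (pathGraph (k + 2))) h i = (2 * ((k : ℝ) + 2) ^ 2 - 4 * ((k : ℝ) + 2) + 3) / 6 := by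
  rw [PalaciosRenom2010_cor_1 (pathGraph_connected (k + 1)) hh i, card_edgeFinset_pathGraph (k + 1)]
  have hinner : ∀ x : Fin (k + 2), ∑ y, ((pathGraph (k + 2)).degree x : ℝ) * ((pathGraph (k + 2)).degree y : ℝ) *
      effectiveResistance ((pathGraph (k + 2)).adjMatrix ℝ) x y =
      ((pathGraph (k + 2)).degree x : ℝ) * (((x : ℕ) : ℝ) ^ 2 + (((k : ℝ) + 1) - ((x : ℕ) : ℝ)) ^ 2) := fun x => by
    rw [← FaughtKemptonKnudson2021_prop_3_2_moment_path x, Finset.mul_sum]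
    refine sum_congr rfl fun y _ => ?_
    rw [FaughtKemptonKnudson2021_prop_3_1_path x y, FaughtKemptonKnudson2021_prop_3_1_path y x, abs_sub_comm]
    ring
  simp_rw [hinner]
  rw [sum_degree_mul_pathGraph]
  simp only [Fin.val_zero, Fin.val_last, Nat.cast_zero, Nat.cast_add, Nat.cast_one]
  have hsq : ∑ x : Fin (k + 2), (((x : ℕ) : ℝ) ^ 2 + (((k : ℝ) + 1) - ((x : ℕ) : ℝ)) ^ 2) =
      ((k : ℝ) + 2) * ((k : ℝ) + 1) * (2 * (k : ℝ) + 3) / 3 := by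
    have hx : ∀ x : Fin (k + 2), (((x : ℕ) : ℝ) ^ 2 + (((k : ℝ) + 1) - ((x : ℕ) : ℝ)) ^ 2) =
        2 * ((x : ℕ) : ℝ) ^ 2 + ((k : ℝ) + 1) ^ 2 - (2 * ((k : ℝ) + 1)) * ((x : ℕ) : ℝ) := fun x => by ring
    simp_rw [hx]
    rw [Finset.sum_sub_distrib, Finset.sum_add_distrib, ← Finset.mul_sum, ← Finset.mul_sum, sum_const, card_univ,
      Fintype.card_fin, nsmul_eq_mul,
      Fin.sum_univ_eq_sum_range (fun i : ℕ => (i : ℝ) ^ 2) (k + 2), Fin.sum_univ_eq_sum_range (fun i : ℕ => (i : ℝ)) (k + 2),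
      sum_range_cast_sq_sixth, sum_range_cast_id_half]
    push_cast
    ring
  rw [hsq]
  field_simp
  ring

end Literature.Probability.MarkovChains
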